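import Summits.BirchSwinnertonDyer.Rank1Residual.X12.O11.StrictSelmerIndexModTorsion
import Summits.BirchSwinnertonDyer.Rank1Residual.Additive.LocalLogImageRat
import Summits.BirchSwinnertonDyer.BirchSwinnertonDyer.Theorems.KatoDescentPotSupersingularStrictSelmerBridge
import HarnessLib

set_option autoImplicit false

/-!
# THE STRICT SELMER COUNT MODULO TORSION AND THE LEVEL `ñ = v(log_ω P) − e` (seat `bsd-cm-prr-ty1` g12, cell `bsd-cm`;
# theorems only: no definition, no named fact, no instance, no `sorry`)

Part 31a of the seat's kernel cut of stub 3 `stub_rankOneCountReadingKato` of the Kato–Perrin-Riou skeletons v4 (cruxes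
stmt-BirchSwinnertonDyer-19945 / -19223); plan (α)-I of planner D512 (3) / D514 (2) / D519: the arithmetic link between
Kato's `KatoH2CountAt` ((14.14.2) + (14.9.3): `n · #W(ℚ)[p^∞] = #Sel_str · #W(ℚ_p)[p^∞]`) and the counting display
COUNT-FINEᵃ of stub 3 is the STRICT SELMER COUNT `#Sel_str = p^ñ · [S_Σ : Sel_{p^∞}] · #Ш[p^∞]` with `ñ = v(log_ω P) − e`.
This file is its field-independent half; Part 31b (`KatoDescentStrictSelmerCount.lean`) assembles it on the rows.
* §1 (number field `K`, perfect `K`-field `E`, generator `P` of `E(K)` modulo torsion of infinite order, `λ : E(E) → ℤ_p`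
  with kernel the torsion and `p^b ℤ_p ⊆ im λ`; `p`-TORSION IN `E(E)` ALLOWED) **`card_inf_strict_eq_pow_mul_relIndex_modTorsion`**:
  for EVERY subgroup `S` of `H¹(K, E[p^∞])` between the Kummer image `im κ = ker (H¹(K,E[p^∞]) → H¹(K,E))` and the local
  Kummer condition at `E`: `#(S ⊓ Sel_str@E) = p^ñ · [S : im κ]`, `ñ` the level of `P` in `E(E)` MODULO TORSION (the snake
  of Greenberg LNM 1716 §2: `S ⊓ strict ↠ S / im κ` with kernel the strict Kummer classes `≅ ℤ/p^ñ`; generalises X12.O11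
  `card_strictSelmer_eq_pow_mul_card_sha_modTorsion`, the case `S = Sel_{p^∞}`); with `[Sel_{p^∞} : im κ] = #Ш[p^∞]`:
  **`#(S ⊓ Sel_str@E) = p^ñ · [S : Sel_{p^∞}] · #Ш[p^∞]`** for `Sel_{p^∞} ≤ S`.
* §2 for a SURJECTIVE `λ` the mod-torsion level is `v(λ X)`; from `log_ω(E(ℚ_p)) = p^e ℤ_p`, `e = t − v_p(c_p)` (tree
  `LocalLog.range_padicLog_baseChange_of_addv`, additive `p`) the surjective `λ = p^{−e} log_ω` with kernel the torsion, and
  **`v(λ X) = v(log_ω X) − e`**.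
* §3 the strict condition at `K_v` IS «`loc_v = 0`» (`primaryPointsMap` bijective; X11b `resH1Hom_eq_zero_iff_of_range_eq`);
  §4 two transport helpers along `ℚ_{v_p} ≅ ℚ_p`.
HONEST LABEL: theorems only; no stub or item is closed; nothing is registered; nothing is asserted on 19945 / 19223;
Kato's Main Conjecture and Perrin-Riou's conjecture are not touched; BSD is not proved for any curve.
References: [Kato2004Asterisque] §14.1 (p. 235), (14.9.3) (p. 240), (14.14.2) (p. 243), Prop. 14.16 (p. 244);
[GreenbergLNM1716] §2 (pp. 62–63), Lemma 3.3; [Kim2022StructureSelmer] §3.2.3, Lemma 3.10; [SilvermanAEC2009] III.6.4,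
IV.6.4, VII.6.3; [SerreGaloisCohomology1997] I.§2.4, I.§5.1; [MilneADT2006] I Cor. 2.3.
-/

noncomputable section

open scoped Classical NumberField ContRepresentation

open WeierstrassCurve Field IsDedekindDomain NumberField CategoryTheory Literature.NumberTheory.EllipticCurves
  Literature.NumberTheory.EllipticCurves.Kato2004 Literature.NumberTheory.GaloisRepresentations
  Literature.NumberTheory.GaloisRepresentations.DiscreteGaloisModule
  Literature.NumberTheory.EllipticCurves.Kato2004.EulerSystemValues
open WeierstrassCurve (geomPoints geomTorsion geomPrimaryTorsion galH1Primary kummerMapTorsion)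
open Summit.BirchSwinnertonDyer.Rank1Residual.Additive.StrictSha Summit.BirchSwinnertonDyer.Rank1Residual.X12.O11
open Summit.BirchSwinnertonDyer.Rank1Residual.X11b.LocBridge Literature.NumberTheory.EllipticCurves.Rank1Residual

universe u

namespace Summit.BirchSwinnertonDyer.Rank1Residual.Additive.StrictCount

/-! ## §1 `#(S ⊓ Sel_str@E) = p^ñ · [S : im κ]` for every `S` between the Kummer image and the Kummer condition at `E` -/

section General

/-- **`#(S ⊓ Sel_str@E) = p^ñ · [S : im κ]`, local `p`-torsion allowed.** For an elliptic curve `E` over a number field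
`K`, a prime `p`, a perfect `K`-field `E` with `λ : E(E) → ℤ_p` (kernel = torsion, `p^b ℤ_p ⊆ im λ`), `E(K) = ℤ·P +
E(K)_tors` with `P` of infinite order whose image in `E(E)` has exact level `ñ` modulo torsion (`hdivP`, `hndiv`), and for
EVERY subgroup `S ≤ H¹(K, E[p^∞])` with `ker (H¹(K,E[p^∞]) → H¹(K,E)) ≤ S` (`hDS`: `S` contains the Kummer image
`E(K) ⊗ ℚ_p/ℤ_p`) and `S ≤` (local Kummer condition at `E`) (`hSloc`):
`Nat.card (S ⊓ Sel_str@E) = p^ñ · [S : ker]` (`relIndex`; `0 = 0` if the index is infinite).  Proof = X12.O11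
`card_strictSelmer_eq_pow_mul_card_sha_modTorsion` with `Sel_{p^∞}` replaced by `S`: the map `S ⊓ strict → H¹(K, E)`
has image the image of `S` (every class of `S` is strict up to a Kummer class:
`exists_sub_kummerMapLevel_mem_selmerLocalKerPrimaryTorsion`) and kernel the STRICT Kummer classes `{κ_ñ(a·P)} ≅ ℤ/p^ñ`.
[cite: GreenbergLNM1716, §2 (pp. 62–63)] [cite: KuriharaPollack2007, §1.5 (p. 361)] [cite: SilvermanAEC2009, Prop. VII.6.3] -/
theorem card_inf_strict_eq_pow_mul_relIndex_modTorsion {K : Type u} [Field K] [NumberField K]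
    (W : WeierstrassCurve K) [W.IsElliptic] (p : ℕ) [Fact p.Prime]
    (E : Type u) [Field E] [Algebra K E] [PerfectField E]
    (lam : (W.baseChange E).toAffine.Point →+ ℤ_[p]) {b : ℕ}
    (hlam : ∀ X, lam X = 0 ↔ IsOfFinAddOrder X)
    (hlamb : ∀ z : ℤ_[p], ∃ Y, lam Y = (p : ℤ_[p]) ^ b * z)
    (S : AddSubgroup (galH1Primary W p)) (hSloc : S ≤ selmerLocalKerPrimary W E p)
    (hDS : (primaryH1ToH1 W p).ker ≤ S)
    {P : W.toAffine.Point} {n : ℕ} (hP : ¬ IsOfFinAddOrder P)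
    (hgen : ∀ R : W.toAffine.Point, ∃ (k : ℤ) (T : W.toAffine.Point),
      IsOfFinAddOrder T ∧ R = k • P + T)
    (hdivP : ∃ Q T : (W.baseChange E).toAffine.Point, IsOfFinAddOrder T ∧
      p ^ n • Q = Affine.Point.baseChange (W' := W) K E P + T)
    (hndiv : ∀ Q T : (W.baseChange E).toAffine.Point, IsOfFinAddOrder T →
      p ^ (n + 1) • Q ≠ Affine.Point.baseChange (W' := W) K E P + T) :
    Nat.card ↥(S ⊓ selmerLocalKerPrimaryTorsion W E p) = p ^ n * (primaryH1ToH1 W p).ker.relIndex S := by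
  have hpP : p.Prime := Fact.out
  have hdiv : W.zsmul_geomPoints_surjective := W.zsmul_geomPoints_surjective_holds
  let bc : W.toAffine.Point →+ (W.baseChange E).toAffine.Point :=
    Affine.Point.baseChange (W' := W) K E
  have hbc : ∀ X, Affine.Point.baseChange (W' := W) K E X = bc X := fun _ => rfl
  have hinj : Function.Injective bc := Affine.Point.map_injective (W' := W) (Algebra.ofId K E)
  obtain ⟨Q, T₀, hT₀, hQ⟩ := hdivP
  rw [hbc] at hQ
  have hndiv' : ∀ Q' T' : (W.baseChange E).toAffine.Point, IsOfFinAddOrder T' →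
      p ^ (n + 1) • Q' ≠ bc P + T' := fun Q' T' hT' => by rw [← hbc]; exact hndiv Q' T' hT'
  have hu0 : lam (bc P) ≠ 0 := by
    intro h0
    apply hP
    obtain ⟨m, hm, hmP⟩ := isOfFinAddOrder_iff_nsmul_eq_zero.mp ((hlam _).mp h0)
    refine isOfFinAddOrder_iff_nsmul_eq_zero.mpr ⟨m, hm, hinj ?_⟩
    rw [map_nsmul, map_zero]
    exact hmP
  set S₀ := S ⊓ selmerLocalKerPrimaryTorsion W E p with hS₀
  set πS : S₀ →+ W.galH1 := (primaryH1ToH1 W p).comp S₀.subtype with hπS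
  -- Kummer classes of multiples of `P` lie in `S`
  have hκS : ∀ (m : ℕ) (a : ℤ), kummerMapLevel W p hdiv m (a • P) ∈ S := fun m a =>
    hDS ((AddMonoidHom.mem_ker).mpr (primaryH1ToH1_kummerMapLevel W p hdiv m (a • P)))
  -- (i) the image of `S₀` in `H¹(K, E)` is the image of `S` (core of `StrictSelmerDominatesSha`)
  have hrange : πS.range = S.map (primaryH1ToH1 W p) := by
    ext x
    constructor
    · rintro ⟨c, rfl⟩
      exact ⟨c, c.2.1, rfl⟩
    · rintro ⟨s, hs, rfl⟩
      obtain ⟨m, a, hstr⟩ := exists_sub_kummerMapLevel_mem_selmerLocalKerPrimaryTorsion W p hdiv E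
        lam hlam hlamb P hu0 s (hSloc hs)
      refine ⟨⟨s - kummerMapLevel W p hdiv m (a • P), S.sub_mem hs (hκS m a), hstr⟩, ?_⟩
      change primaryH1ToH1 W p (s - kummerMapLevel W p hdiv m (a • P)) = primaryH1ToH1 W p s
      rw [map_sub, primaryH1ToH1_kummerMapLevel, sub_zero]
  have hcardRange : Nat.card πS.range = (primaryH1ToH1 W p).ker.relIndex S := by
    rw [hrange, AddSubgroup.relIndex, AddSubgroup.index, AddSubgroup.addSubgroupOf, AddMonoidHom.comap_ker,
      Nat.card_congr (QuotientAddGroup.quotientKerEquivRange ((primaryH1ToH1 W p).comp S.subtype)).toEquiv,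
      AddMonoidHom.range_comp, AddSubgroup.range_subtype]
  -- (ii) the kernel of `πS` = the STRICT Kummer classes = `{κ_n(a • P)}` ≅ `ℤ/p^n`
  set φ : ℤ →+ galH1Primary W p := (kummerMapLevel W p hdiv n).comp (zmultiplesHom _ P) with hφdef
  have hφ : ∀ a : ℤ, φ a = kummerMapLevel W p hdiv n (a • P) := fun a => by
    rw [hφdef, AddMonoidHom.comp_apply, zmultiplesHom_apply]
  have hkerφ : φ.ker = AddSubgroup.zmultiples ((p ^ n : ℕ) : ℤ) := by
    ext a
    rw [AddMonoidHom.mem_ker, hφ, AddSubgroup.mem_zmultiples_iff]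
    constructor
    · intro h0
      obtain ⟨m, P₀, hP₀⟩ := exists_of_kummerMapLevel_eq_zero W p hdiv n (a • P) h0
      obtain ⟨k, T, hT, rfl⟩ := hgen P₀
      -- `(p^m a − p^(n+m) k) • P = p^(n+m) • T` is torsion, so the scalar vanishes
      have hc : ((p ^ m : ℕ) * a - (p ^ (n + m) : ℕ) * k : ℤ) • P = p ^ (n + m) • T := by
        rw [sub_smul, mul_smul, mul_smul, natCast_zsmul, natCast_zsmul, hP₀, smul_add]
        abel
      have hc0 := zsmul_eq_zero_of_isOfFinAddOrder hP (hc ▸ hT.nsmul)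
      refine ⟨k, ?_⟩
      have h1 : ((p ^ m : ℕ) : ℤ) * a = ((p ^ m : ℕ) : ℤ) * ((p ^ n : ℕ) * k) := by
        push_cast at hc0 ⊢
        linear_combination hc0
      have hpm : ((p ^ m : ℕ) : ℤ) ≠ 0 := by exact_mod_cast pow_ne_zero m hpP.ne_zero
      rw [mul_left_cancel₀ hpm h1, smul_eq_mul, mul_comm]
    · rintro ⟨k, rfl⟩
      rw [smul_eq_mul, mul_smul, natCast_zsmul, smul_comm, kummerMapLevel_nsmul_self]
  have hrangeφ : φ.range = (πS.ker).map S₀.subtype := by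
    ext x
    constructor
    · rintro ⟨a, rfl⟩
      rw [hφ]
      have hker : primaryH1ToH1 W p (kummerMapLevel W p hdiv n (a • P)) = 0 :=
        primaryH1ToH1_kummerMapLevel W p hdiv n (a • P)
      -- strictness MODULO TORSION: `bc(a • P) + a • T₀ = p^n • (a • Q)`
      have haT₀ : IsOfFinAddOrder (a • T₀) := by
        rw [← hlam, map_zsmul, (hlam T₀).mpr hT₀, smul_zero]
      have hstr : kummerMapLevel W p hdiv n (a • P) ∈ selmerLocalKerPrimaryTorsion W E p :=
        kummerMapLevel_mem_selmerLocalKerPrimaryTorsion_of_add_torsion_eq_nsmul W p hdiv E n (a • P)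
          (a • Q) (a • T₀) haT₀ (by rw [hbc, map_zsmul, ← smul_add, ← hQ, smul_comm])
      exact ⟨⟨kummerMapLevel W p hdiv n (a • P), hκS n a, hstr⟩, hker, rfl⟩
    · rintro ⟨c, hc, rfl⟩
      have hc0 : primaryH1ToH1 W p c = 0 := hc
      have hcker : (c : galH1Primary W p) ∈ (kummerMapPInfty W p hdiv).range := by
        rw [range_kummerMapPInfty W p hdiv]
        exact hc0
      obtain ⟨t, ht⟩ := hcker
      obtain ⟨R', N, rfl⟩ := exists_eq_tmul_prufGen W p t
      rw [kummerMapPInfty_tmul_prufGen] at ht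
      obtain ⟨k, T, hT, rfl⟩ := hgen R'
      rw [map_add, kummerMapLevel_eq_zero_of_isOfFinAddOrder W p hdiv N hT, add_zero] at ht
      -- the class is strict: `res κ_N(k • P) = 0`
      have hres : resH1Hom (resGal (K := K) E) (primaryPointsMap W E p)
          (primaryPointsMap_smul W E p) (kummerMapLevel W p hdiv N (k • P)) = 0 := by
        have h2 : (c : galH1Primary W p) ∈ selmerLocalKerPrimaryTorsion W E p := c.2.2
        rw [← ht] at h2
        exact h2
      change (c : galH1Primary W p) ∈ φ.range
      rw [← ht]
      rcases eq_or_ne k 0 with rfl | hk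
      · exact ⟨0, by rw [zero_smul, map_zero, map_zero]⟩
      obtain ⟨R, T', hT', hRT⟩ :=
        exists_eq_nsmul_add_of_res_kummerMapLevel_eq_zero W p hdiv E N (k • P) hres
      rw [hbc, map_zsmul] at hRT
      have hle : N ≤ n + padicValInt p k :=
        le_add_padicValInt_of_zsmul_eq_nsmul_add_modTorsion p lam hlam hT₀ hQ hndiv' hk hT' hRT
      -- `p^(N-n) ∣ k`, so `κ_N(k • P)` has level `n`
      obtain ⟨k₂, hk₂⟩ : (p : ℤ) ^ (N - n) ∣ k :=
        (padicValInt_dvd_iff (N - n) k).mpr (Or.inr (by omega))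
      rcases le_or_gt n N with hnN | hNn
      · refine ⟨k₂, ?_⟩
        rw [hφ, hk₂, mul_smul, ← Nat.cast_pow, natCast_zsmul]
        exact (kummerMapLevel_level W p hdiv n (N - n) N (by omega) (k₂ • P)).symm
      · refine ⟨(p : ℤ) ^ (n - N) * k, ?_⟩
        rw [hφ, mul_smul, ← Nat.cast_pow, natCast_zsmul]
        exact kummerMapLevel_level W p hdiv N (n - N) n (by omega) (k • P)
  have hcardKer : Nat.card πS.ker = p ^ n := by
    have e1 : Nat.card πS.ker = Nat.card φ.range := by
      rw [hrangeφ]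
      exact Nat.card_congr (πS.ker.equivMapOfInjective S₀.subtype Subtype.val_injective).toEquiv
    rw [e1, ← Nat.card_congr (QuotientAddGroup.quotientKerEquivRange φ).toEquiv, hkerφ,
      Nat.card_congr (Int.quotientZMultiplesNatEquivZMod (p ^ n)).toEquiv, Nat.card_zmod]
  -- (iii) counting
  rw [AddSubgroup.card_eq_card_quotient_mul_card_addSubgroup πS.ker,
    Nat.card_congr (QuotientAddGroup.quotientKerEquivRange πS).toEquiv, hcardRange, hcardKer, mul_comm]

/-- **`[Sel_{p^∞}(E/K) : im κ] = #Ш(E/K)[p^∞]`**: the index in `Sel_{p^∞}` of the Kummer image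
`ker (H¹(K,E[p^∞]) → H¹(K,E))` is the order of `Ш[p^∞]` (the image of `Sel_{p^∞}` in `H¹(K,E)` is `Ш[p^∞]`,
`map_primaryH1ToH1_selmerGroupPInfty`; `0 = 0` when `Ш[p^∞]` is infinite). [cite: GreenbergLNM1716, §2 (p. 63)] -/
theorem relIndex_ker_primaryH1ToH1_selmerGroupPInfty {K : Type u} [Field K] [NumberField K]
    (W : WeierstrassCurve K) [W.IsElliptic] (p : ℕ) [Fact p.Prime] :
    (primaryH1ToH1 W p).ker.relIndex (W.selmerGroupPInfty p) =
      Nat.card (AddCommGroup.primaryComponent W.sha p) := by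
  rw [AddSubgroup.relIndex, AddSubgroup.index, AddSubgroup.addSubgroupOf, AddMonoidHom.comap_ker,
    Nat.card_congr (QuotientAddGroup.quotientKerEquivRange
      ((primaryH1ToH1 W p).comp (W.selmerGroupPInfty p).subtype)).toEquiv,
    AddMonoidHom.range_comp, AddSubgroup.range_subtype,
    map_primaryH1ToH1_selmerGroupPInfty W p W.zsmul_geomPoints_surjective_holds]
  exact Nat.card_congr ((AddCommGroup.primaryComponent W.sha p).equivMapOfInjective
    W.sha.subtype Subtype.val_injective).toEquiv.symm

/-- **`#(S ⊓ Sel_str@E) = p^ñ · [S : Sel_{p^∞}] · #Ш[p^∞]`** for `Sel_{p^∞} ≤ S ≤` (Kummer at `E`): §1 with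
`[S : im κ] = [S : Sel_{p^∞}] · [Sel_{p^∞} : im κ]`. [cite: GreenbergLNM1716, §2 (pp. 62–63)] [cite: KuriharaPollack2007, §1.5 (p. 361)] -/
theorem card_inf_strict_eq_pow_mul_relIndex_mul_card_sha_modTorsion {K : Type u} [Field K] [NumberField K]
    (W : WeierstrassCurve K) [W.IsElliptic] (p : ℕ) [Fact p.Prime]
    (E : Type u) [Field E] [Algebra K E] [PerfectField E]
    (lam : (W.baseChange E).toAffine.Point →+ ℤ_[p]) {b : ℕ}
    (hlam : ∀ X, lam X = 0 ↔ IsOfFinAddOrder X)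
    (hlamb : ∀ z : ℤ_[p], ∃ Y, lam Y = (p : ℤ_[p]) ^ b * z)
    (S : AddSubgroup (galH1Primary W p)) (hSloc : S ≤ selmerLocalKerPrimary W E p)
    (hSelS : W.selmerGroupPInfty p ≤ S)
    {P : W.toAffine.Point} {n : ℕ} (hP : ¬ IsOfFinAddOrder P)
    (hgen : ∀ R : W.toAffine.Point, ∃ (k : ℤ) (T : W.toAffine.Point),
      IsOfFinAddOrder T ∧ R = k • P + T)
    (hdivP : ∃ Q T : (W.baseChange E).toAffine.Point, IsOfFinAddOrder T ∧
      p ^ n • Q = Affine.Point.baseChange (W' := W) K E P + T)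
    (hndiv : ∀ Q T : (W.baseChange E).toAffine.Point, IsOfFinAddOrder T →
      p ^ (n + 1) • Q ≠ Affine.Point.baseChange (W' := W) K E P + T) :
    Nat.card ↥(S ⊓ selmerLocalKerPrimaryTorsion W E p) =
      p ^ n * ((W.selmerGroupPInfty p).relIndex S * Nat.card (AddCommGroup.primaryComponent W.sha p)) := by
  rw [card_inf_strict_eq_pow_mul_relIndex_modTorsion W p E lam hlam hlamb S hSloc
      ((ker_primaryH1ToH1_le_selmerGroupPInfty W p).trans hSelS) hP hgen hdivP hndiv,
    ← relIndex_ker_primaryH1ToH1_selmerGroupPInfty W p, mul_comm ((W.selmerGroupPInfty p).relIndex S),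
    AddSubgroup.relIndex_mul_relIndex _ _ _ (ker_primaryH1ToH1_le_selmerGroupPInfty W p) hSelS]

end General

/-! ## §2 The mod-torsion level through a surjective `λ : E(ℚ_p) → ℤ_p` with kernel the torsion; `λ = p^{−e} log_ω` -/

section Level

/-- **For a SURJECTIVE `λ` with kernel the torsion, the level of `X` modulo torsion is `v(λ X)`**: there are `Q`, `T`
(`T` torsion) with `p^{v(λX)} • Q = X + T`, and none with `p^{v(λX)+1}`.  (`λ X = u · p^v`, `u` a unit: take `λ Q = u`;
conversely `p^{v+1} λ Q = λ X` forces `v(λ X) ≥ v + 1`.) [cite: SilvermanAEC2009, Prop. VII.6.3] -/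
theorem modTorsion_level_of_surjective {G : Type*} [AddCommGroup G] (p : ℕ) [Fact p.Prime]
    (lam : G →+ ℤ_[p]) (hlam : ∀ X, lam X = 0 ↔ IsOfFinAddOrder X) (hsurj : Function.Surjective lam)
    {X : G} (hX : lam X ≠ 0) :
    (∃ Q T : G, IsOfFinAddOrder T ∧ p ^ (lam X).valuation • Q = X + T) ∧
      ∀ Q T : G, IsOfFinAddOrder T → p ^ ((lam X).valuation + 1) • Q ≠ X + T := by
  constructor
  · obtain ⟨Q, hQ⟩ := hsurj (PadicInt.unitCoeff hX : ℤ_[p])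
    refine ⟨Q, p ^ (lam X).valuation • Q - X, ?_, by abel⟩
    rw [← hlam, map_sub, map_nsmul, hQ, nsmul_eq_mul, Nat.cast_pow, sub_eq_zero, mul_comm]
    exact (PadicInt.unitCoeff_spec hX).symm
  · intro Q T hT h
    have h1 := congrArg lam h
    rw [map_nsmul, map_add, (hlam T).mpr hT, add_zero, nsmul_eq_mul, Nat.cast_pow] at h1
    have hQ0 : lam Q ≠ 0 := by
      intro h0; rw [h0, mul_zero] at h1; exact hX h1.symm
    have h2 := PadicInt.valuation_p_pow_mul ((lam X).valuation + 1) (lam Q) hQ0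
    rw [h1] at h2
    omega

/-- **`λ = p^{−e} · log_ω : E(ℚ_p) → ℤ_p` is a SURJECTIVE homomorphism with kernel the torsion** whenever
`log_ω(E(ℚ_p)) = p^e ℤ_p` (`e ∈ ℤ`; tree `LocalLog.range_padicLog_baseChange_of_addv`: `e = t − v_p c_p` at an additive `p`,
`LocalLog.padicLog_eq_zero_iff`: kernel = torsion). [cite: SilvermanAEC2009, IV.6.4 and VII.6.3] [cite: Kim2022StructureSelmer, §3.2.3 and Lemma 3.10] -/
theorem exists_hom_padicInt_of_range_padicLog {p : ℕ} [Fact p.Prime] (X : WeierstrassCurve ℚ_[p])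
    [X.IsIntegral ℤ_[p]] [X.IsElliptic] {e : ℤ}
    (hrange : (LocalLog.padicLog X).range = (Submodule.span ℤ_[p] {(p : ℚ_[p]) ^ e}).toAddSubgroup) :
    ∃ lam : X.toAffine.Point →+ ℤ_[p], (∀ Q, lam Q = 0 ↔ IsOfFinAddOrder Q) ∧ Function.Surjective lam ∧
      ∀ Q, ((lam Q : ℤ_[p]) : ℚ_[p]) = (p : ℚ_[p]) ^ (-e) * LocalLog.padicLog X Q := by
  have hp : p.Prime := Fact.out
  have hp0 : (p : ℚ_[p]) ≠ 0 := Nat.cast_ne_zero.mpr hp.ne_zero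
  have hpe : (p : ℚ_[p]) ^ e ≠ 0 := zpow_ne_zero e hp0
  -- `p^{-e} · log Q ∈ ℤ_p`
  have hmem : ∀ Q, ∃ c : ℤ_[p], (p : ℚ_[p]) ^ (-e) * LocalLog.padicLog X Q = c := fun Q => by
    have h : LocalLog.padicLog X Q ∈ (LocalLog.padicLog X).range := ⟨Q, rfl⟩
    rw [hrange] at h
    obtain ⟨c, hc⟩ := Submodule.mem_span_singleton.mp h
    refine ⟨c, ?_⟩
    rw [← hc, Algebra.smul_def, zpow_neg, ← mul_assoc, mul_comm _ (algebraMap ℤ_[p] ℚ_[p] c), mul_assoc,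
      inv_mul_cancel₀ hpe, mul_one]
    rfl
  have hnorm : ∀ Q, ‖(p : ℚ_[p]) ^ (-e) * LocalLog.padicLog X Q‖ ≤ 1 := fun Q => by
    obtain ⟨c, hc⟩ := hmem Q
    rw [hc]
    exact c.2
  let lam : X.toAffine.Point →+ ℤ_[p] :=
    { toFun := fun Q => ⟨(p : ℚ_[p]) ^ (-e) * LocalLog.padicLog X Q, hnorm Q⟩
      map_zero' := Subtype.ext (by simp only [map_zero, mul_zero]; rfl)
      map_add' := fun Q Q' => Subtype.ext (by
        change (p : ℚ_[p]) ^ (-e) * LocalLog.padicLog X (Q + Q') = _ * _ + _ * _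
        rw [map_add, mul_add]) }
  have hlam : ∀ Q, ((lam Q : ℤ_[p]) : ℚ_[p]) = (p : ℚ_[p]) ^ (-e) * LocalLog.padicLog X Q := fun _ => rfl
  refine ⟨lam, fun Q => ?_, fun z => ?_, hlam⟩
  · rw [← LocalLog.padicLog_eq_zero_iff, ← PadicInt.coe_eq_zero, hlam, mul_eq_zero,
      or_iff_right (zpow_ne_zero _ hp0)]
  · have hz : (z : ℚ_[p]) * (p : ℚ_[p]) ^ e ∈ (LocalLog.padicLog X).range := by
      rw [hrange]
      exact Submodule.mem_span_singleton.mpr ⟨z, by rw [Algebra.smul_def]; rfl⟩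
    obtain ⟨Q, hQ⟩ := hz
    refine ⟨Q, Subtype.coe_injective ?_⟩
    change ((lam Q : ℤ_[p]) : ℚ_[p]) = (z : ℚ_[p])
    rw [hlam, hQ, zpow_neg, mul_comm, mul_assoc, mul_inv_cancel₀ hpe, mul_one]

/-- **The level modulo torsion is `v(log_ω X) − e`**: with `λ = p^{−e} log_ω` (surjective, kernel = torsion), for a
point `X` of infinite order `ñ := v(λ X)` satisfies `(ñ : ℤ) = v(log_ω X) − e` and is the exact level of `X` modulo torsion.
[cite: SilvermanAEC2009, Prop. VII.6.3] [cite: Kim2022StructureSelmer, §3.2.3] -/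
theorem valuation_eq_valuation_padicLog_sub {p : ℕ} [Fact p.Prime] (X : WeierstrassCurve ℚ_[p])
    [X.IsIntegral ℤ_[p]] [X.IsElliptic] {e : ℤ} (lam : X.toAffine.Point →+ ℤ_[p])
    (hlam : ∀ Q, ((lam Q : ℤ_[p]) : ℚ_[p]) = (p : ℚ_[p]) ^ (-e) * LocalLog.padicLog X Q)
    {Q : X.toAffine.Point} (hQ : lam Q ≠ 0) :
    ((lam Q).valuation : ℤ) = (LocalLog.padicLog X Q).valuation - e := by
  have hp : p.Prime := Fact.out
  have hp0 : (p : ℚ_[p]) ≠ 0 := Nat.cast_ne_zero.mpr hp.ne_zero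
  have hlog : LocalLog.padicLog X Q ≠ 0 := by
    intro h0; apply hQ; apply PadicInt.coe_eq_zero.mp; rw [hlam, h0, mul_zero]
  rw [← PadicInt.valuation_coe, hlam, Padic.valuation_mul (zpow_ne_zero _ hp0) hlog, Padic.valuation_zpow,
    Padic.valuation_p, mul_one]
  ring

end Level

/-! ## §3 The strict local condition at `v` is «`loc_v = 0`»; `Sel_str = S_Σ ⊓ Sel_str@v_p` -/

section Strict

variable {K : Type} [Field K] [NumberField K] (W : WeierstrassCurve K) [W.IsElliptic] (p : ℕ) [hp : Fact p.Prime]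

/-- `primaryPointsMap : E[p^∞](K̄) → E(K̄_E)[p^∞]` is bijective for every `K`-field `E` (injective as a restriction of
the injective `ι_*`; surjective because every `p^k`-torsion point of `E(K̄_E)` comes from `E[p^k](K̄)`,
`exists_pointsMapOfEmb_eq_of_nsmul_eq_zero`). [cite: SilvermanAEC2009, Cor. III.6.4(b)] -/
theorem primaryPointsMap_bijective (E : Type) [Field E] [Algebra K E] :
    Function.Bijective (primaryPointsMap W E p) := by
  refine ⟨fun P Q h ↦ Subtype.ext
      (pointsMapOfEmb_injective W (closureEmb (K := K) E) (congrArg Subtype.val h)), fun Q ↦ ?_⟩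
  obtain ⟨k, hk⟩ := (AddCommGroup.mem_primaryComponent).mp Q.2
  obtain ⟨P, hP, hPQ⟩ := exists_pointsMapOfEmb_eq_of_nsmul_eq_zero W (closureEmb (K := K) E)
    (pow_ne_zero k hp.out.ne_zero) hk
  exact ⟨⟨P, (AddCommGroup.mem_primaryComponent).mpr ⟨k, hP⟩⟩, Subtype.ext hPQ⟩

/-- **The strict condition at the completion `K_v` IS «`loc_v c = 0`»**: a class `c ∈ H¹(K, E[p^∞])` dies in
`H¹(K_v, E(K̄_v)[p^∞])` (`selmerLocalKerPrimaryTorsion W K_v p`, along `(resGal K_v, primaryPointsMap)`) iff its localisation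
`loc_v c ∈ H¹(K_v, E[p^∞])` vanishes: the coefficient map is bijective (`primaryPointsMap_bijective`), so the kernel only depends
on the range `D_v = decomp v` of `Γ_{K_v} → Γ_K` (X11b `resH1Hom_eq_zero_iff_of_range_eq`), and restriction to `D_v` vanishes iff
`loc_v = 0` (potss `StrictSelmerBridge.localization_primary_eq_zero_iff_mem_subgroupResKer`).
[cite: SerreGaloisCohomology1997, I.§2.4 and I.§5.1] [cite: GreenbergLNM1716, §2] -/
theorem mem_selmerLocalKerPrimaryTorsion_adicCompletion_iff_localization_eq_zero (v : HeightOneSpectrum (𝓞 K))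
    (c : galH1Primary W p) :
    c ∈ selmerLocalKerPrimaryTorsion W (v.adicCompletion K) p ↔
      galoisCohomology.localization (primaryGaloisModule W p) (Sum.inr v) 1 c = 0 := by
  rw [BirchSwinnertonDyer.Theorems.StrictSelmerBridge.localization_primary_eq_zero_iff_mem_subgroupResKer,
    ResKernel.mem_subgroupResKer_iff, selmerLocalKerPrimaryTorsion, resKer_eq_ker, AddMonoidHom.mem_ker,
    ResKernel.resSubgroup]
  refine resH1Hom_eq_zero_iff_of_range_eq (resGal (K := K) (v.adicCompletion K)) (primaryPointsMap W _ p)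
    (primaryPointsMap_smul W _ p) (primaryPointsMap_bijective W p _)
    (Literature.NumberTheory.EllipticCurves.subgroupIncl _) (AddMonoidHom.id _) (fun _ _ ↦ rfl)
    Function.bijective_id ?_ c
  rw [range_subgroupIncl, resGal_eq_absGaloisRestrict]
  rfl


end Strict

/-! ## §4 Transport along `ℚ_{v_p} ≅ ℚ_p` -/

section Transport

/-- A map of points along an algebra endomorphism that is the identity on elements is the identity on points.
[cite: SilvermanAEC2009, III.§2 (points under base change)] -/
theorem point_map_eq_self_of_forall_apply_eq {R : Type*} [CommRing R] (W : WeierstrassCurve R) {S : Type*} [CommRing S]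
    [Algebra R S] {F : Type*} [Field F] [Algebra R F] [Algebra S F] [IsScalarTower R S F]
    (f : F →ₐ[S] F) (hf : ∀ x, f x = x) (P : (W.baseChange F).toAffine.Point) :
    Affine.Point.map (W' := W) f P = P := by
  rcases P with _ | @⟨x, y, h⟩
  · rfl
  · simp only [Affine.Point.map_some, hf]

/-- `#A[p^∞] = #B[p^∞]` along an additive isomorphism given by two mutually inverse homomorphisms. [folklore] -/
theorem natCard_primaryComponent_eq_of_inverse {A B : Type*} [AddCommGroup A] [AddCommGroup B] (f : A →+ B) (g : B →+ A)
    (hgf : ∀ a, g (f a) = a) (hfg : ∀ b, f (g b) = b) (p : ℕ) :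
    Nat.card (AddCommGroup.primaryComponent A p) = Nat.card (AddCommGroup.primaryComponent B p) :=
  natCard_primaryComponent_congr
    ({ toFun := f, invFun := g, left_inv := hgf, right_inv := hfg, map_add' := fun a b => map_add f a b } : A ≃+ B) p

end Transport

end Summit.BirchSwinnertonDyer.Rank1Residual.Additive.StrictCount

end
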